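import Summits.Ventures.HodgeRepro2.T5SU11SphericalSecondKind

/-!
# The solution space of the radial equation at `λ = 2n + 2` on `(0, ∞)` is spanned by `φ_{2n+2}(a_t)` and `Q_n(cosh 2t)`

For two solutions `u₁, u₂` of `sinh 2t · u″ + 2 cosh 2t · u′ = μ sinh 2t · u` on `(0, ∞)` the function
`sinh 2t · (u₁ u₂′ − u₁′ u₂)` has zero derivative (`hasDerivAt_sinh_mul_wronskian`), hence is constant on `(0, ∞)`
(`sinh_mul_wronskian_const`) — Abel's identity. For the two explicit solutions `φ(t) = φ_{2n+2}(a_t) = P_n(cosh 2t)`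
(row 384) and `v(t) = Q_n(cosh 2t)` (row 441) this constant is `−2` (row 441's Wronskian), and the pointwise
identity `u · W(φ, v) = W(u, v) · φ + W(φ, u) · v` (`wronskian_identity`, pure algebra) expresses EVERY solution
`u` as

  **`u(t) = a φ_{2n+2}(a_t) + b Q_n(cosh 2t)` on `(0, ∞)` with constants `a = −½ c(u, v)`, `b = −½ c(φ, u)`**
  (`exists_eq_add_of_ode`),

where `c(·, ·)` are the constants of Abel's identity: the solution space of the radial equation of the explicit
model at `λ = 2n + 2` on `(0, ∞)` is two-dimensional, spanned by the spherical function and the second-kind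
function. Nothing is claimed about (N).

Blind lane: Mathlib + the HodgeRepro2 prefix only; no sorry; axioms ⊆ {propext, Classical.choice,
Quot.sound}.
-/

namespace Summit.Ventures.HodgeRepro2.T5SU11SphericalSolutionSpace

open Filter Topology
open Set (Ioi)
open T5SU11SphericalLegendreAll T5SU11SphericalLegendreHigher T5SU11LegendreIdentities T5SU11LegendreSecondKind
  T5SU11LegendreSecondKindODE T5SU11LegendreWronskian T5SU11SphericalSecondKind T5SU11Cartan
  T5SU11SphericalFunction

/-! ### Abel's identity -/

section abel

variable {μ : ℝ} {u₁ u₁' u₁'' u₂ u₂' u₂'' : ℝ → ℝ}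
  (h₁ : ∀ t, 0 < t → HasDerivAt u₁ (u₁' t) t) (h₁' : ∀ t, 0 < t → HasDerivAt u₁' (u₁'' t) t)
  (hode₁ : ∀ t, 0 < t → Real.sinh (2 * t) * u₁'' t + 2 * Real.cosh (2 * t) * u₁' t = μ * Real.sinh (2 * t) * u₁ t)
  (h₂ : ∀ t, 0 < t → HasDerivAt u₂ (u₂' t) t) (h₂' : ∀ t, 0 < t → HasDerivAt u₂' (u₂'' t) t)
  (hode₂ : ∀ t, 0 < t → Real.sinh (2 * t) * u₂'' t + 2 * Real.cosh (2 * t) * u₂' t = μ * Real.sinh (2 * t) * u₂ t)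
include h₁ h₁' hode₁ h₂ h₂' hode₂

/-- **Abel's identity, differential form**: `(sinh 2t · (u₁ u₂′ − u₁′ u₂))′ = 0` on `(0, ∞)`. -/
theorem hasDerivAt_sinh_mul_wronskian {t : ℝ} (ht : 0 < t) :
    HasDerivAt (fun t => Real.sinh (2 * t) * (u₁ t * u₂' t - u₁' t * u₂ t)) 0 t := by
  have h := (hasDerivAt_sinh_two_mul_self t).mul
    (((h₁ t ht).mul (h₂' t ht)).sub ((h₁' t ht).mul (h₂ t ht)))
  refine h.congr_deriv ?_
  have e₁ := hode₁ t ht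
  have e₂ := hode₂ t ht
  simp only [Pi.sub_apply, Pi.mul_apply]
  linear_combination (u₁ t) * e₂ - (u₂ t) * e₁

/-- **Abel's identity**: `sinh 2t · (u₁ u₂′ − u₁′ u₂)` is constant on `(0, ∞)`. -/
theorem sinh_mul_wronskian_const {s t : ℝ} (hs : 0 < s) (ht : 0 < t) :
    Real.sinh (2 * s) * (u₁ s * u₂' s - u₁' s * u₂ s) = Real.sinh (2 * t) * (u₁ t * u₂' t - u₁' t * u₂ t) :=
  IsOpen.is_const_of_deriv_eq_zero isOpen_Ioi isPreconnected_Ioi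
    (fun _ hz => (hasDerivAt_sinh_mul_wronskian h₁ h₁' hode₁ h₂ h₂' hode₂ hz.out).differentiableAt.differentiableWithinAt)
    (fun _ hz => (hasDerivAt_sinh_mul_wronskian h₁ h₁' hode₁ h₂ h₂' hode₂ hz.out).deriv) hs ht

end abel

/-! ### The two explicit solutions -/

/-- `φ′` has derivative `φ″`. -/
theorem hasDerivAt_sph_even_hyp' (n : ℕ) (t : ℝ) :
    HasDerivAt (fun t => 2 * Real.sinh (2 * t) * legQ n (Real.cosh (2 * t)))
      (4 * Real.cosh (2 * t) * legQ n (Real.cosh (2 * t)) + 4 * Real.sinh (2 * t) ^ 2 * legR n (Real.cosh (2 * t)))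
      t := by
  have h := ((hasDerivAt_sinh_two_mul_self t).const_mul 2).mul
    ((hasDerivAt_legQ n (Real.cosh (2 * t))).comp t (hasDerivAt_cosh_two_mul_self t))
  refine h.congr_deriv ?_
  simp only [Function.comp_apply]
  ring

/-- The pointwise identity `u · W(φ, v) = W(u, v) · φ + W(φ, u) · v` (pure algebra). -/
theorem wronskian_identity (u u' φ φ' v v' : ℝ) :
    u * (φ * v' - φ' * v) = (u * v' - u' * v) * φ + (φ * u' - φ' * u) * v := by ring

section measure

variable [MeasurableSpace Circle] [BorelSpace Circle]

/-- `φ(t) = φ_{2n+2}(a_t)` solves the radial equation on `(0, ∞)` (row 384's `P_n(cosh 2t)` with row 399's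
equation), with the derivative data `φ′ = 2 sinh 2t · P′_n(cosh 2t)`, `φ″ = 4 cosh 2t · P′_n + 4 sinh² 2t · P″_n`. -/
theorem sph_even_hyp_ode (n : ℕ) {t : ℝ} (_ht : 0 < t) :
    Real.sinh (2 * t) * (4 * Real.cosh (2 * t) * legQ n (Real.cosh (2 * t))
        + 4 * Real.sinh (2 * t) ^ 2 * legR n (Real.cosh (2 * t)))
      + 2 * Real.cosh (2 * t) * (2 * Real.sinh (2 * t) * legQ n (Real.cosh (2 * t)))
      = (2 * (n : ℝ) + 2) * ((2 * (n : ℝ) + 2) - 2) * Real.sinh (2 * t) * sph (2 * (n : ℝ) + 2) (hyp t) := by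
  rw [sph_even_hyp]
  have hode := legendre_ode n (Real.cosh (2 * t))
  have hcs : Real.sinh (2 * t) ^ 2 = Real.cosh (2 * t) ^ 2 - 1 := by
    have := Real.cosh_sq (2 * t)
    linarith
  rw [hcs]
  linear_combination (4 * Real.sinh (2 * t)) * hode

/-- **THE SOLUTION SPACE**: every solution `u` of `sinh 2t · u″ + 2 cosh 2t · u′ = (2n + 2)(2n) sinh 2t · u` on
`(0, ∞)` is a linear combination of `φ_{2n+2}(a_t)` and `Q_n(cosh 2t)` there, with constant coefficients. -/
theorem exists_eq_add_of_ode (n : ℕ) {u u' u'' : ℝ → ℝ} (hu : ∀ t, 0 < t → HasDerivAt u (u' t) t)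
    (hu' : ∀ t, 0 < t → HasDerivAt u' (u'' t) t)
    (hode : ∀ t, 0 < t → Real.sinh (2 * t) * u'' t + 2 * Real.cosh (2 * t) * u' t
      = (2 * (n : ℝ) + 2) * ((2 * (n : ℝ) + 2) - 2) * Real.sinh (2 * t) * u t) :
    ∃ a b : ℝ, ∀ t, 0 < t → u t = a * sph (2 * (n : ℝ) + 2) (hyp t) + b * sphQ n t := by
  -- the two explicit solutions with their derivative data
  set φ : ℝ → ℝ := fun t => sph (2 * (n : ℝ) + 2) (hyp t) with hφ
  set φ' : ℝ → ℝ := fun t => 2 * Real.sinh (2 * t) * legQ n (Real.cosh (2 * t)) with hφ'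
  set φ'' : ℝ → ℝ := fun t => 4 * Real.cosh (2 * t) * legQ n (Real.cosh (2 * t))
    + 4 * Real.sinh (2 * t) ^ 2 * legR n (Real.cosh (2 * t)) with hφ''
  have hφd : ∀ t, 0 < t → HasDerivAt φ (φ' t) t := fun t _ => hasDerivAt_sph_even_hyp n t
  have hφd' : ∀ t, 0 < t → HasDerivAt φ' (φ'' t) t := fun t _ => hasDerivAt_sph_even_hyp' n t
  have hφode : ∀ t, 0 < t → Real.sinh (2 * t) * φ'' t + 2 * Real.cosh (2 * t) * φ' t
      = (2 * (n : ℝ) + 2) * ((2 * (n : ℝ) + 2) - 2) * Real.sinh (2 * t) * φ t :=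
    fun t ht => sph_even_hyp_ode n ht
  have hvd : ∀ t, 0 < t → HasDerivAt (sphQ n) (sphQ' n t) t := fun t ht => hasDerivAt_sphQ n ht.ne'
  have hvd' : ∀ t, 0 < t → HasDerivAt (sphQ' n) (sphQ'' n t) t := fun t ht => hasDerivAt_sphQ' n ht.ne'
  have hvode : ∀ t, 0 < t → Real.sinh (2 * t) * sphQ'' n t + 2 * Real.cosh (2 * t) * sphQ' n t
      = (2 * (n : ℝ) + 2) * ((2 * (n : ℝ) + 2) - 2) * Real.sinh (2 * t) * sphQ n t :=
    fun t ht => sphQ_ode n ht.ne'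
  -- Abel's constants, evaluated at `t = 1`
  set cuv := Real.sinh 2 * (u 1 * sphQ' n 1 - u' 1 * sphQ n 1) with hcuv
  set cφu := Real.sinh 2 * (φ 1 * u' 1 - φ' 1 * u 1) with hcφu
  refine ⟨-(1 / 2) * cuv, -(1 / 2) * cφu, fun t ht => ?_⟩
  have hS : Real.sinh (2 * t) ≠ 0 := by
    rw [Ne, Real.sinh_eq_zero]
    exact mul_ne_zero two_ne_zero ht.ne'
  -- the three Wronskians at `t`
  have hW_φv : Real.sinh (2 * t) * (φ t * sphQ' n t - φ' t * sphQ n t) = -2 := by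
    have := wronskian_sphQ n ht.ne'
    simp only [hφ, hφ']
    rw [this]
    field_simp
  have hW_uv : Real.sinh (2 * t) * (u t * sphQ' n t - u' t * sphQ n t) = cuv := by
    have := sinh_mul_wronskian_const hu hu' hode hvd hvd' hvode ht one_pos
    rw [this, hcuv]
    norm_num
  have hW_φu : Real.sinh (2 * t) * (φ t * u' t - φ' t * u t) = cφu := by
    have := sinh_mul_wronskian_const hφd hφd' hφode hu hu' hode ht one_pos
    rw [this, hcφu]
    norm_num
  -- the algebraic identity, multiplied by `sinh 2t`
  have key := wronskian_identity (u t) (u' t) (φ t) (φ' t) (sphQ n t) (sphQ' n t)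
  have e : Real.sinh (2 * t) * (u t * (φ t * sphQ' n t - φ' t * sphQ n t))
      = Real.sinh (2 * t) * ((u t * sphQ' n t - u' t * sphQ n t) * φ t + (φ t * u' t - φ' t * u t) * sphQ n t) := by
    rw [key]
  have e2 : u t * (-2) = cuv * φ t + cφu * sphQ n t := by
    rw [← hW_φv, ← hW_uv, ← hW_φu]
    linear_combination e
  simp only [hφ] at e2 ⊢
  linarith

end measure

end Summit.Ventures.HodgeRepro2.T5SU11SphericalSolutionSpace
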